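import Summits.AnomalousDissipation.AnomalousDissipation.Theses.NeutralTaylorWaves
import Summits.AnomalousDissipation.AnomalousDissipation.Theorems.NonresonantSelection.Negative.TranslationMode

/-!
# Negative lemmas for crux `NeutralTaylorWaves.NonresonantSelection` (stmt-AnomalousDissipation-16294):
# a second translation symmetry of the force is inherited by bordered steady states

The route realises (crux `NewtonRealisation`) exact smooth steady states of ONE fixed
`x₃`-invariant force `f` from quasi-steady states carrying the BORDERED a-priori bound of the crux's
consequent `NonresonantTaylorWaves` ("nonresonant modulo the `x₃`-phase": the translation mode `∂₃w`
is bordered by `⟨v, ∂₃w⟩`, cf. `unbordered_false_of_steadyState`). This file shows, kernel-checked,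
that the border absorbs EXACTLY ONE translation symmetry (cdisprove cycle 1, 2026-08-17):

* `linearisation_add_smul` — the linearised steady operator is linear in the test pair `(v, r)`.
* `bordered_secondSymmetry_rigidity` — if `f` is ALSO invariant under `xᵢ`-translations, then at
  every exact smooth steady state `(w, q, c)` of `f` the bordered bound (with ANY constant `M`)
  forces `∂ᵢw ≡ t ∂₃w` with the constant `t = ⟨∂ᵢw, ∂₃w⟩ / ‖∂₃w‖₂²`: the border-corrected
  translation mode `∂ᵢw − t∂₃w` is an exact kernel vector orthogonal to the border, so it must
  vanish. Hence a bordered-nonresonant steady state cannot break a second continuous symmetry of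
  its force: it is invariant along `eᵢ − t e₃`. Consequences for the crux: the single smooth force of
  any witness family that is realised this way must break every translation symmetry except `x₃`
  (no Kolmogorov-type one-coordinate forces, no `x₁`- or `x₂`-independent cellular forces), which is
  the formal content of the crux-attack note "any force with a second continuous symmetry is killed".

Tools: `linearisation_partialDeriv_eq`, `isDivFree_partialDeriv` (sibling file `TranslationMode`),
`bordered_one_le` (`BorderedTestVectors`), torus calculus linearity lemmas. [folklore]
-/

set_option linter.dupNamespace false

noncomputable section

namespace Summit.AnomalousDissipation.AnomalousDissipation.Theorems.NonresonantSelection.Negative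

open MeasureTheory
open Literature.Analysis.FunctionSpaces
open Literature.Analysis.FluidPDE

/-! ## A second translation symmetry of the force is inherited by bordered steady states -/

/-- `∇(φ + s•ψ) = ∇φ + s•∇ψ` for smooth scalars. [folklore] -/
private theorem gradient_add_smul' {φ ψ : UnitAddTorus (Fin 3) → ℝ} (hφ : Torus.IsSmooth φ)
    (hψ : Torus.IsSmooth ψ) (s : ℝ) (x : UnitAddTorus (Fin 3)) :
    Torus.gradient (φ + s • ψ) x = Torus.gradient φ x + s • Torus.gradient ψ x := by
  refine ext_inner_right ℝ fun e => ?_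
  rw [Torus.inner_gradient_left, Torus.fderiv_add (hφ.isContDiff (by simp)) ((hψ.smul s).isContDiff (by simp)),
    Torus.fderiv_const_smul (hψ.isContDiff (by simp)), inner_add_left, inner_smul_left,
    Torus.inner_gradient_left, Torus.inner_gradient_left]
  simp

/-- `Δ(f + s•g) = Δf + s•Δg` for smooth fields. [folklore] -/
private theorem laplacian_add_smul' {f g : UnitAddTorus (Fin 3) → EuclideanSpace ℝ (Fin 3)}
    (hf : Torus.IsSmooth f) (hg : Torus.IsSmooth g) (s : ℝ) (x : UnitAddTorus (Fin 3)) :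
    Torus.laplacian (f + s • g) x = Torus.laplacian f x + s • Torus.laplacian g x := by
  rw [Torus.laplacian_add_apply hf (hg.smul s) x, Torus.laplacian_const_smul_apply hg s x]

/-- `∂ᵢ(f + s•g) = ∂ᵢf + s•∂ᵢg` for smooth fields. [folklore] -/
private theorem partialDeriv_add_smul' {f g : UnitAddTorus (Fin 3) → EuclideanSpace ℝ (Fin 3)}
    (hf : Torus.IsSmooth f) (hg : Torus.IsSmooth g) (s : ℝ) (i : Fin 3) (x : UnitAddTorus (Fin 3)) :
    Torus.partialDeriv i (f + s • g) x = Torus.partialDeriv i f x + s • Torus.partialDeriv i g x := by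
  rw [Torus.partialDeriv_add (hf.isContDiff (by simp)) ((hg.smul s).isContDiff (by simp)), Pi.add_apply,
    Torus.partialDeriv_const_smul (hg.isContDiff (by simp)) s i, Pi.smul_apply]

/-- `(w·∇)(f + s•g) = (w·∇)f + s•(w·∇)g` for smooth fields. [folklore] -/
private theorem convect_add_smul_right' {w f g : UnitAddTorus (Fin 3) → EuclideanSpace ℝ (Fin 3)}
    (hf : Torus.IsSmooth f) (hg : Torus.IsSmooth g) (s : ℝ) (x : UnitAddTorus (Fin 3)) :
    Torus.convect w (f + s • g) x = Torus.convect w f x + s • Torus.convect w g x := by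
  unfold Torus.convect
  rw [Torus.fderiv_add (hf.isContDiff (by simp)) ((hg.smul s).isContDiff (by simp)),
    Torus.fderiv_const_smul (hg.isContDiff (by simp))]
  rfl

/-- `((f + s•g)·∇)w = (f·∇)w + s•(g·∇)w` (linearity of `Dw(x)`). [folklore] -/
private theorem convect_add_smul_left' (w f g : UnitAddTorus (Fin 3) → EuclideanSpace ℝ (Fin 3))
    (s : ℝ) (x : UnitAddTorus (Fin 3)) :
    Torus.convect (f + s • g) w x = Torus.convect f w x + s • Torus.convect g w x := by
  unfold Torus.convect
  simp only [Pi.add_apply, Pi.smul_apply, map_add, map_smul]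

/-- Coordinates of `f + s • g`. [folklore] -/
private theorem coord_add_smul' (f g : UnitAddTorus (Fin 3) → EuclideanSpace ℝ (Fin 3)) (s : ℝ) (j : Fin 3) :
    (fun y => (f + s • g) y j) = (fun y => f y j) + s • (fun y => g y j) := by
  funext y
  simp [Pi.add_apply, Pi.smul_apply]

/-- Linear combinations of smooth divergence-free fields are divergence free. [folklore] -/
private theorem isDivFree_add_smul' {f g : UnitAddTorus (Fin 3) → EuclideanSpace ℝ (Fin 3)}
    (hf : Torus.IsSmooth f) (hg : Torus.IsSmooth g) (hfd : Torus.IsDivFree f) (hgd : Torus.IsDivFree g)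
    (s : ℝ) : Torus.IsDivFree (f + s • g) := by
  intro x
  have hf0 := hfd x
  have hg0 := hgd x
  simp only [Torus.divergence] at hf0 hg0 ⊢
  have hterm : ∀ j : Fin 3, Torus.partialDeriv j (fun y => (f + s • g) y j) x
      = Torus.partialDeriv j (fun y => f y j) x + s * Torus.partialDeriv j (fun y => g y j) x := by
    intro j
    rw [coord_add_smul' f g s j,
      Torus.partialDeriv_add ((hf.apply j).isContDiff (by simp)) (((hg.apply j).smul s).isContDiff (by simp)),
      Pi.add_apply, Torus.partialDeriv_const_smul ((hg.apply j).isContDiff (by simp)) s j, Pi.smul_apply,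
      smul_eq_mul]
  simp only [hterm, Finset.sum_add_distrib, ← Finset.mul_sum, hf0, hg0, mul_zero, add_zero]

/-- Linear combinations of smooth mean-zero fields have zero mean. [folklore] -/
private theorem hasZeroMean_add_smul' {f g : UnitAddTorus (Fin 3) → EuclideanSpace ℝ (Fin 3)}
    (hf : Torus.IsSmooth f) (hg : Torus.IsSmooth g) (hfm : Torus.HasZeroMean f) (hgm : Torus.HasZeroMean g)
    (s : ℝ) : Torus.HasZeroMean (f + s • g) := by
  unfold Torus.HasZeroMean at hfm hgm ⊢
  have h1 : (fun x => (f + s • g) x) = fun x => f x + s • g x := by funext x; simp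
  have h2 : Integrable (fun x => s • g x) volume := hg.integrable.smul s
  rw [h1, integral_add hf.integrable h2, integral_smul, hfm, hgm, smul_zero, add_zero]

/-- **Linearity of the linearised steady operator in the test pair `(v, r)`.** [folklore] -/
theorem linearisation_add_smul {ν c : ℝ} {w v₁ v₂ : UnitAddTorus (Fin 3) → EuclideanSpace ℝ (Fin 3)}
    {r₁ r₂ : UnitAddTorus (Fin 3) → ℝ} (hv₁ : Torus.IsSmooth v₁) (hv₂ : Torus.IsSmooth v₂)
    (hr₁ : Torus.IsSmooth r₁) (hr₂ : Torus.IsSmooth r₂) (s : ℝ) (x : UnitAddTorus (Fin 3)) :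
    Torus.convect w (v₁ + s • v₂) x + Torus.convect (v₁ + s • v₂) w x
        - ν • Torus.laplacian (v₁ + s • v₂) x + Torus.gradient (r₁ + s • r₂) x
        - c • Torus.partialDeriv (2 : Fin 3) (v₁ + s • v₂) x
      = (Torus.convect w v₁ x + Torus.convect v₁ w x - ν • Torus.laplacian v₁ x + Torus.gradient r₁ x
          - c • Torus.partialDeriv (2 : Fin 3) v₁ x)
        + s • (Torus.convect w v₂ x + Torus.convect v₂ w x - ν • Torus.laplacian v₂ x + Torus.gradient r₂ x
          - c • Torus.partialDeriv (2 : Fin 3) v₂ x) := by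
  rw [convect_add_smul_right' hv₁ hv₂, convect_add_smul_left', laplacian_add_smul' hv₁ hv₂,
    gradient_add_smul' hr₁ hr₂, partialDeriv_add_smul' hv₁ hv₂]
  module

/-- A continuous non-negative function on `T³` with vanishing integral vanishes identically
(the Haar measure charges open sets). [folklore] -/
private theorem eq_zero_of_integral_eq_zero' {g : UnitAddTorus (Fin 3) → ℝ} (hg : Continuous g)
    (h0 : ∀ x, 0 ≤ g x) (hint : MeasureTheory.integral MeasureTheory.volume g = 0) (x : UnitAddTorus (Fin 3)) :
    g x = 0 := by
  have hi : Integrable g volume := hg.integrable_of_hasCompactSupport (HasCompactSupport.of_compactSpace g)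
  have hae : g =ᵐ[volume] 0 := (integral_eq_zero_iff_of_nonneg (fun y => h0 y) hi).1 hint
  have hfun := (Continuous.ae_eq_iff_eq volume hg continuous_const).1 hae
  exact congrFun hfun x

/-- **Rigidity under a second translation symmetry (border-corrected test field
`∂ᵢw − t∂₃w`).** Let `(w, q, c)` be an exact smooth steady state, `(w·∇)w − νΔw + ∇q − c∂₃w = f`,
of a force that is invariant under `x₃`-translations AND under `xᵢ`-translations
(`∂₃f ≡ 0`, `∂ᵢf ≡ 0`). If the BORDERED a-priori bound (last clause of
`NeutralTaylorWaves.NonresonantTaylorWaves`, verbatim) holds at `(w, c)` with ANY constant `M`, then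
`∂ᵢw ≡ t ∂₃w` for the constant `t = ⟨∂ᵢw, ∂₃w⟩/‖∂₃w‖₂²`: the state inherits the second symmetry as
invariance along the direction `eᵢ − t e₃` (no spontaneous breaking of a second continuous symmetry
is compatible with bordered nonresonance). Proof: `∂ᵢw − t∂₃w` is an exact kernel vector of the
linearisation (translation identity, twice), `t` is chosen to kill the phase border, and
`‖∂₃w‖₂ > 0` by the border test `(0,0,1)`. In particular a force depending on one coordinate only
(Kolmogorov type) admits no bordered-nonresonant steady state other than fields
`w(x) = W(x₁ + a x₃, x₂ + b x₃)`-like lifts, and the route's force must break every translation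
symmetry but `x₃`. [folklore] -/
theorem bordered_secondSymmetry_rigidity {ν : ℝ} {w f : UnitAddTorus (Fin 3) → EuclideanSpace ℝ (Fin 3)}
    {q : UnitAddTorus (Fin 3) → ℝ} {c M : ℝ} (hw : Torus.IsSmooth w) (hq : Torus.IsSmooth q)
    (hdiv : Torus.IsDivFree w)
    (hsteady : ∀ x, Torus.convect w w x - ν • Torus.laplacian w x + Torus.gradient q x
      - c • Torus.partialDeriv (2 : Fin 3) w x = f x)
    (i : Fin 3) (hfi : ∀ x, Torus.partialDeriv i f x = 0)
    (hf3 : ∀ x, Torus.partialDeriv (2 : Fin 3) f x = 0)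
    (hB : ∀ (v : UnitAddTorus (Fin 3) → EuclideanSpace ℝ (Fin 3)) (r : UnitAddTorus (Fin 3) → ℝ) (b : ℝ),
      Torus.IsSmooth v → Torus.IsSmooth r → Torus.IsDivFree v → Torus.HasZeroMean v →
      MeasureTheory.integral MeasureTheory.volume (fun x => ‖v x‖ ^ 2) + b ^ 2 ≤
        M ^ 2 * (MeasureTheory.integral MeasureTheory.volume (fun x =>
          ‖Torus.convect w v x + Torus.convect v w x - ν • Torus.laplacian v x +
            Torus.gradient r x - c • Torus.partialDeriv (2 : Fin 3) v x -
            b • Torus.partialDeriv (2 : Fin 3) w x‖ ^ 2) +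
          (MeasureTheory.integral MeasureTheory.volume (fun x =>
            inner ℝ (v x) (Torus.partialDeriv (2 : Fin 3) w x))) ^ 2)) :
    ∃ t : ℝ, ∀ x, Torus.partialDeriv i w x = t • Torus.partialDeriv (2 : Fin 3) w x := by
  -- notation-free abbreviations
  set w3 := Torus.partialDeriv (2 : Fin 3) w with hw3def
  set wi := Torus.partialDeriv i w with hwidef
  have hw3 : Torus.IsSmooth w3 := hw.partialDeriv 2
  have hwi : Torus.IsSmooth wi := hw.partialDeriv i
  -- D = ‖∂₃w‖₂² > 0 from the border test (0,0,1)
  set D := MeasureTheory.integral MeasureTheory.volume (fun x => ‖w3 x‖ ^ 2) with hDdef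
  have hD1 : 1 ≤ M ^ 2 * D := bordered_one_le hB
  have hDpos : 0 < D := by
    by_contra hle
    have hle' : D ≤ 0 := le_of_not_gt hle
    have : M ^ 2 * D ≤ 0 := mul_nonpos_of_nonneg_of_nonpos (sq_nonneg M) hle'
    linarith
  set P := MeasureTheory.integral MeasureTheory.volume (fun x => inner ℝ (wi x) (w3 x)) with hPdef
  set s : ℝ := -(P / D) with hsdef
  -- the border-corrected test field and its admissibility
  have hv : Torus.IsSmooth (wi + s • w3) := hwi.add (hw3.smul s)
  have hr : Torus.IsSmooth (Torus.partialDeriv i q + s • Torus.partialDeriv (2 : Fin 3) q) :=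
    (hq.partialDeriv i).add ((hq.partialDeriv 2).smul s)
  have hvd : Torus.IsDivFree (wi + s • w3) :=
    isDivFree_add_smul' hwi hw3 (isDivFree_partialDeriv hw hdiv i) (isDivFree_partialDeriv hw hdiv 2) s
  have hvm : Torus.HasZeroMean (wi + s • w3) :=
    hasZeroMean_add_smul' hwi hw3 (Torus.hasZeroMean_partialDeriv hw i) (Torus.hasZeroMean_partialDeriv hw 2) s
  have key := hB (wi + s • w3) (Torus.partialDeriv i q + s • Torus.partialDeriv (2 : Fin 3) q) 0 hv hr hvd hvm
  -- the linearisation annihilates the test pair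
  have hS : (fun y => Torus.convect w w y - ν • Torus.laplacian w y
      + Torus.gradient q y - c • Torus.partialDeriv (2 : Fin 3) w y) = f := funext hsteady
  have hL : ∀ x, Torus.convect w (wi + s • w3) x + Torus.convect (wi + s • w3) w x
      - ν • Torus.laplacian (wi + s • w3) x
      + Torus.gradient (Torus.partialDeriv i q + s • Torus.partialDeriv (2 : Fin 3) q) x
      - c • Torus.partialDeriv (2 : Fin 3) (wi + s • w3) x
      - (0 : ℝ) • Torus.partialDeriv (2 : Fin 3) w x = 0 := by
    intro x
    rw [zero_smul, sub_zero,
      linearisation_add_smul (w := w) (ν := ν) (c := c) hwi hw3 (hq.partialDeriv i) (hq.partialDeriv 2) s x,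
      hwidef, hw3def, linearisation_partialDeriv_eq hw hq ν c i x,
      linearisation_partialDeriv_eq hw hq ν c 2 x, hS, hfi x, hf3 x, smul_zero, add_zero]
  -- the phase border vanishes by the choice of `s`
  have hint_i : Integrable (fun x => inner ℝ (wi x) (w3 x)) volume := (hwi.inner hw3).integrable
  have hint_3 : Integrable (fun x => inner ℝ (w3 x) (w3 x)) volume := (hw3.inner hw3).integrable
  have hD' : MeasureTheory.integral MeasureTheory.volume (fun x => inner ℝ (w3 x) (w3 x)) = D := by
    rw [hDdef]
    refine integral_congr_ae (ae_of_all _ fun x => ?_)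
    simp only [real_inner_self_eq_norm_sq]
  have hborder : MeasureTheory.integral MeasureTheory.volume
      (fun x => inner ℝ ((wi + s • w3) x) (Torus.partialDeriv (2 : Fin 3) w x)) = 0 := by
    have h1 : (fun x => inner ℝ ((wi + s • w3) x) (Torus.partialDeriv (2 : Fin 3) w x))
        = fun x => inner ℝ (wi x) (w3 x) + s * inner ℝ (w3 x) (w3 x) := by
      funext x
      simp only [Pi.add_apply, Pi.smul_apply, inner_add_left, inner_smul_left, RCLike.conj_to_real, ← hw3def]
    rw [h1, integral_add hint_i (hint_3.const_mul s), integral_const_mul, hD', ← hPdef, hsdef]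
    field_simp
    ring
  -- hence ∫‖v‖² ≤ 0, so v ≡ 0
  have hzero : ∀ x, ‖(wi + s • w3) x‖ ^ 2 = 0 := by
    have hle : MeasureTheory.integral MeasureTheory.volume (fun x => ‖(wi + s • w3) x‖ ^ 2) ≤ 0 := by
      have h2 : (fun x => ‖Torus.convect w (wi + s • w3) x + Torus.convect (wi + s • w3) w x
          - ν • Torus.laplacian (wi + s • w3) x
          + Torus.gradient (Torus.partialDeriv i q + s • Torus.partialDeriv (2 : Fin 3) q) x
          - c • Torus.partialDeriv (2 : Fin 3) (wi + s • w3) x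
          - (0 : ℝ) • Torus.partialDeriv (2 : Fin 3) w x‖ ^ 2) = fun _ => (0 : ℝ) := by
        funext x
        rw [hL x, norm_zero, zero_pow two_ne_zero]
      rw [h2, hborder] at key
      simpa using key
    have hnn : ∀ x, 0 ≤ ‖(wi + s • w3) x‖ ^ 2 := fun x => sq_nonneg _
    have hint0 : MeasureTheory.integral MeasureTheory.volume (fun x => ‖(wi + s • w3) x‖ ^ 2) = 0 :=
      le_antisymm hle (integral_nonneg hnn)
    exact eq_zero_of_integral_eq_zero' (hv.norm_sq.continuous) hnn hint0
  refine ⟨P / D, fun x => ?_⟩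
  have hx : wi x + s • w3 x = 0 := by
    have := hzero x
    rw [sq_eq_zero_iff, norm_eq_zero] at this
    simpa using this
  rw [hsdef, neg_smul] at hx
  exact (sub_eq_zero.mp (by simpa [sub_eq_add_neg] using hx))

end Summit.AnomalousDissipation.AnomalousDissipation.Theorems.NonresonantSelection.Negative

end
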